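import Summits.ABC.IUTFork.LDHSlotRegimePointNecessitySharpRegime
import HarnessLib

/-!
# Crux `ThetaPartII` (stmt-ABC-19678), (U) line RESHAPE-4: `hregBad` / `stub_hullRegimeAboveBad` are false MODULO one Szpiro-bad
# admissible point with a mixed pair beating the sharp slack — the kernel half of plan RULING C-R35 (2) «NOT-HREGBAD?»

Record-only PROOF file (D-0012) of the abc-iut cell (R2 S-chain team, seat abc-iut-s2-p5 gen 2); TAKES NO SIDE on [IUTchIII] Cor. 3.12,
on [IUTchIV] Thm. 1.10, or on the (U)/(P) readings of "`−|log(Θ)|`". S. Mochizuki, *IUT IV* [Mochizuki2012], Thm. 1.10 proof Steps (ii),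
(v)–(viii) pp. 24, 27–31; Cor. 2.2 (ii) proof pp. 44–46. [claim: Mochizuki2012, status: disputed] for every IUT quotation.

After `Conditional.not_hreg_v4` / `Negative.stub_hullRegimeAbove_false` (abc-iut-s2-p5 gen 2, p453135 / p455039) the crux chain re-cut the
(U) line (abc-iut-c312-8 RESHAPE-4, sha16 `3177a83aca8d622d`; abc-iut-s2-p2 p452755; abc-iut-c312-d1 p450130): the CONE binder is now
demanded only at SZPIRO-BAD admissible `(λ, l)` — `(l+5)/4 < d_mod ∨ 6l((l+5) − 4d_mod)/((l+4)(l−3))·(log-diff + (1 − 1/l)·log-cond) +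
6l(l+5)/((l+4)(l−3))·log π < log q^{∤{2,l}}(λ)` — as `hregBad` (the certificates / the (U) composition
`ThetaPartII.ThetaPartII_of_cor312Bad_of_hullRegimeBad`) and, with `2 ≤ d_mod` and abc-iut-c312-d1's prime-count threshold added, as the
REGISTERED stub `stub_hullRegimeAboveBad` (= the `haboveBad` binder of `ThetaPartII.ABC_of_cor312Bad_of_hullRegimeAboveBad`). THIS FILE is
the negative-modulo lemma for both, in the currency of abc-iut-s2-p1 gen 2's sharp datum-free necessity:

* `Negative.hregBad_false_of_szpiroBadMixedWitness` — IF some admissible `(P, l)` (`λ ∈ U_P`, `l ≥ 5` prime, a core, (P2), (P5), (P6)) is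
  Szpiro-bad (the disjunction VERBATIM), has `4·d_mod ≤ l + 5`, carries a MIXED PAIR (places `V, W` of `F_tpd` over one prime, `V` a pole of
  `j(λ)` dividing neither `2` nor `l`, and `W` either no such pole or of different normalised local height), and a finite set `W₀` of primes
  (each under a non-bad place of positive weight) at which the SHARP SLACK `(4d−1+3d/l)(lD+lC) + ((l+5−4d)/(4l))·lC + ((l+1)/4)·E(l)` is STRICTLY
  BELOW the mixed-height sum, THEN `hregBad` is false (datum by `ThetaPartII.stub_thetaData`; non-slot-constancy by abc-iut-s2-p4's
  `not_slotConstant_of_unequalHeightsPoint`; `PointDict.pointMixedShare_le_sub_gain_of_hullEstimateOf` + the identity «`B_III` − gain = slack»);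
* `Negative.stub_hullRegimeAboveBad_false_of_szpiroBadMixedWitness` — the same for the REGISTERED stub, the witness additionally carrying
  `2 ≤ d_mod` and the threshold `40·log(d*l)·(π(d*l) − (2d(lD+lC) + log 30l)/log 2) < log q^{∤{2,l}}(λ)` (both VERBATIM).

THE NUMERICAL PREDICATE handed to JOB N4 «HREGBAD-HUNT» (abc-iut-rw-num-lead) is exactly the antecedent; note (numbers, not a verdict):
since `4·d_mod ≤ l+5` excludes the first Szpiro-bad disjunct, a witness must satisfy the SECOND one (`log q ≳ 6·(lD + lC)`), and since the
mixed-height sum at any `W₀` is at most `((l+1)/24)·log q^{∤{2,l}}(λ)` while the slack contains `((l+1)/4)·(20/3)·log(d*l)·π(d*l)`, a witness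
also needs `log q^{∤{2,l}}(λ) > 40·log(d*l)·π(d*l) ≥ 5·10⁸` (`d_mod = 2`, `l ≥ 11`) — a normalised height beyond any tabulated abc example;
the explicit families that reach such heights (abc-iut-s2-p5's `P_k`, abc-iut-w5-d126's Gaussian family) are generically Szpiro-GOOD. So the
antecedent is where abc-violating behaviour of enormous height would be needed; nothing here asserts it is inhabited or empty. No side taken;
typed ≠ proved. PROOF-ONLY file: no definitions, no named `Prop` facts. [cite: Mochizuki2012, IUTchIV Thm. 1.10 Steps (ii),(v)–(viii) p. 24, 27–31]
[cite: Mochizuki2012, IUTchIV Cor. 2.2 (ii) proof p. 44–46] [cite: DupuyHilado2025, §3.3, §3.6, §4.7, §4.12]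
-/

noncomputable section

-- `Summit.<Summit>.<Problem>` is the mandated summit-side namespace (CONVENTIONS §2); for the
-- single-conjunct summit `ABC` the two coincide, so the duplicate `ABC.ABC` is deliberate.
set_option linter.dupNamespace false

namespace Summit.ABC.ABC.Theorems.ThetaPartII.Negative

open Literature.NumberTheory.DiophantineGeometry.GenEll Literature.IUT.LogVolume Literature.IUT.HodgeTheaters
open Summit.ABC.IUTFork Summit.ABC.IUTFork.PointDict
open NumberField IsDedekindDomain Literature.NumberTheory.NumberFields
open scoped Classical

/-- The sharp slack IS `B_III` minus the different gain (real identity; abc-iut-s2-p1's `le_slack_of_add_gain_le`). [folklore] -/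
private theorem BIII_sub_gain_eq' {l d lD lC R : ℝ} (hl : 0 < l) :
    (l + 1) / 4 * ((1 + 12 * d / l) * (lD + lC) + R) - ((l + 5) / 4 - d) * (lD + (1 - 1 / l) * lC) =
      (4 * d - 1 + 3 * d / l) * (lD + lC) + (l + 5 - 4 * d) / (4 * l) * lC + (l + 1) / 4 * R := by
  field_simp
  ring

/-- **`hregBad` IS FALSE MODULO ONE SZPIRO-BAD MIXED WITNESS.** If some admissible `(P, l)` — `P ∈ UP`, `l ≥ 5` prime, a core, (P2), (P5),
(P6) — satisfies the Szpiro-bad disjunction of RESHAPE-4 VERBATIM, has `4·d_mod ≤ l + 5`, carries places `V, W` of `F_tpd` over one prime `p₀`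
with `V ∈ 𝕍^bad_{∤2l}` and (`W ∉ 𝕍^bad_{∤2l}` or a different normalised local height), and a finite set `W₀` of primes, each under a
non-(P5)-bad place of `ℚ(j(λ))` of positive weight, at which abc-iut-s2-p1's sharp slack is STRICTLY below the mixed-height sum — THEN the
RESHAPE-4 CONE binder `hregBad` (abc-iut-s2-p2 p452755 / the certificates' `hreg ↦ hregBad`, text VERBATIM) fails: the genuine datum of
`ThetaPartII.stub_thetaData` is not slot-constant (`not_slotConstant_of_unequalHeightsPoint`), `hregBad` yields `T.HullEstimateOf B_III`, and
`PointDict.pointMixedShare_le_sub_gain_of_hullEstimateOf` gives «mixed sum ≤ B_III − gain = slack». An implication; its antecedent is NOT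
asserted. [cite: Mochizuki2012, IUTchIV Thm. 1.10 Steps (v)–(viii) p. 27–31] [claim: Mochizuki2012, status: disputed] -/
theorem hregBad_false_of_szpiroBadMixedWitness
    (H : ∃ (P : NFPoint) (_ : P ∈ UP) (l : ℕ) (_ : l.Prime) (_ : 5 ≤ l) (_ : Cor22.AdmitsCore P)
        (_ : Cor22.CondP2 P l) (_ : Cor22.CondP5 P l) (_ : Cor22.CondP6 P l)
        (_ : ((l : ℝ) + 5) / 4 < (Cor22.dmod P : ℝ) ∨
          6 * l * (((l : ℝ) + 5) - 4 * Cor22.dmod P) / (((l : ℝ) + 4) * ((l : ℝ) - 3))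
              * (P.logDiff + (1 - 1 / (l : ℝ)) * Cor22.logCondAvoid P {2, l})
            + 6 * l * ((l : ℝ) + 5) / (((l : ℝ) + 4) * ((l : ℝ) - 3)) * Real.log Real.pi < Cor22.logQAvoid P {2, l})
        (_ : 4 * (Cor22.dmod P : ℝ) ≤ (l : ℝ) + 5)
        (p₀ : ℕ) (_ : p₀.Prime) (V W : HeightOneSpectrum (𝓞 P.F)) (_ : V ∈ placesOver P.F p₀) (_ : W ∈ placesOver P.F p₀)
        (_ : V ∈ Cor22.badPlacesAvoid P {2, l})
        (_ : W ∈ Cor22.badPlacesAvoid P {2, l} →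
          (ord P.F V (Cor22.jInv P.x) : ℝ) * logNorm P.F V / (localDegree P.F V : ℝ) ≠
            (ord P.F W (Cor22.jInv P.x) : ℝ) * logNorm P.F W / (localDegree P.F W : ℝ))
        (W₀ : Finset ℕ) (_ : ∀ p ∈ W₀, p.Prime)
        (_ : ∀ p ∈ W₀, 0 < ∑ U ∈ Finset.univ.filter
            (fun U : placesOver ↥(IntermediateField.adjoin ℚ ({Cor22.jInv P.x} : Set P.F)) p =>
              ¬ (ord _ U.1 (Cor22.jMod P) < 0 ∧ ((2 : ℕ) : 𝓞 _) ∉ U.1.asIdeal ∧ ((l : ℕ) : 𝓞 _) ∉ U.1.asIdeal)),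
            weight _ U.1),
        (4 * (Cor22.dmod P : ℝ) - 1 + 3 * (Cor22.dmod P : ℝ) / l) * (P.logDiff + Cor22.logCondAvoid P {2, l})
            + ((l : ℝ) + 5 - 4 * (Cor22.dmod P : ℝ)) / (4 * (l : ℝ)) * Cor22.logCondAvoid P {2, l}
            + ((l : ℝ) + 1) / 4 * (2 * Real.log l + 52
              + 20 / 3 * Real.log (((2 ^ 12 * 3 ^ 3 * 5 * Cor22.dmod P : ℕ) : ℝ) * (l : ℝ))
                * (Nat.primeCounting (2 ^ 12 * 3 ^ 3 * 5 * Cor22.dmod P * l) : ℝ)) <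
          ∑ p ∈ W₀, (1 / (2 * (l : ℝ)) *
            ∑ U : placesOver ↥(IntermediateField.adjoin ℚ ({Cor22.jInv P.x} : Set P.F)) p,
              (if ord _ U.1 (Cor22.jMod P) < 0 ∧ ((2 : ℕ) : 𝓞 _) ∉ U.1.asIdeal ∧ ((l : ℕ) : 𝓞 _) ∉ U.1.asIdeal then
                weight _ U.1 * (((-ord _ U.1 (Cor22.jMod P) : ℤ) : ℝ) * logNorm _ U.1 / (localDegree _ U.1 : ℝ))
               else 0)) *
            ((l : ℝ) * ((l : ℝ) + 1) / 12
              - 4 * (1 - ∑ U ∈ Finset.univ.filter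
                    (fun U : placesOver ↥(IntermediateField.adjoin ℚ ({Cor22.jInv P.x} : Set P.F)) p =>
                      ¬ (ord _ U.1 (Cor22.jMod P) < 0 ∧ ((2 : ℕ) : 𝓞 _) ∉ U.1.asIdeal ∧ ((l : ℕ) : 𝓞 _) ∉ U.1.asIdeal)),
                    weight _ U.1) /
                (((l : ℝ) - 1) * (∑ U ∈ Finset.univ.filter
                    (fun U : placesOver ↥(IntermediateField.adjoin ℚ ({Cor22.jInv P.x} : Set P.F)) p =>
                      ¬ (ord _ U.1 (Cor22.jMod P) < 0 ∧ ((2 : ℕ) : 𝓞 _) ∉ U.1.asIdeal ∧ ((l : ℕ) : 𝓞 _) ∉ U.1.asIdeal)),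
                    weight _ U.1) ^ 3))) :
    ¬ (∀ P : NFPoint, P ∈ UP → ∀ l : ℕ, l.Prime → 5 ≤ l →
      Cor22.AdmitsCore P → Cor22.CondP2 P l → Cor22.CondP5 P l → Cor22.CondP6 P l →
      (((l : ℝ) + 5) / 4 < (Cor22.dmod P : ℝ) ∨
        6 * l * (((l : ℝ) + 5) - 4 * Cor22.dmod P) / (((l : ℝ) + 4) * ((l : ℝ) - 3))
            * (P.logDiff + (1 - 1 / (l : ℝ)) * Cor22.logCondAvoid P {2, l})
          + 6 * l * ((l : ℝ) + 5) / (((l : ℝ) + 4) * ((l : ℝ) - 3)) * Real.log Real.pi < Cor22.logQAvoid P {2, l}) →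
      ∀ T : Cor22.ThetaVolumeDatumAt P l,
        (letI := T.instFieldF; letI := T.instNumberFieldF; letI := T.instAlgebraF; letI := T.instFieldK
         letI := T.instNumberFieldK; letI := T.instAlgebraK; letI := T.instFieldFbar; letI := T.instAlgebraFbar
         letI := T.instAlgebraKFbar; letI := T.instIsElliptic
         ¬ (∀ p ∈ T.I.supportPrimes, ∀ v w : placesOver (fieldOfModuli T.E) p,
            (Summit.ABC.IUTFork.DHData.ofInput T.I).logQloc p v = (Summit.ABC.IUTFork.DHData.ofInput T.I).logQloc p w)) →
        T.HullEstimateOf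
          (((l : ℝ) + 1) / 4 *
            ((1 + 12 * (Cor22.dmod P : ℝ) / l) * (P.logDiff + Cor22.logCondAvoid P {2, l})
              + 2 * Real.log l + 52
              + 20 / 3 * Real.log (((2 ^ 12 * 3 ^ 3 * 5 * Cor22.dmod P : ℕ) : ℝ) * (l : ℝ))
                * (Nat.primeCounting (2 ^ 12 * 3 ^ 3 * 5 * Cor22.dmod P * l) : ℝ)))) := by
  intro hregBad
  obtain ⟨P, hP, l, hl, h5, hcore, h2, h5', h6, hbad, h4d, p₀, hp₀, V, W, hV, hW, hVb, hne, W₀, hW₀, hω, hlt⟩ := H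
  haveI : Fact p₀.Prime := ⟨hp₀⟩
  obtain ⟨T⟩ := Summit.ABC.ABC.Theorems.ThetaPartII.stub_thetaData P hP l hl h5 hcore h2 h5' h6
  have hns := not_slotConstant_of_unequalHeightsPoint T hV hW hVb hne
  have hT := hregBad P hP l hl h5 hcore h2 h5' h6 hbad T hns
  have hmix := pointMixedShare_le_sub_gain_of_hullEstimateOf T hT hl.pos h4d W₀ hW₀ hω
  have hl0 : (0 : ℝ) < (l : ℝ) := by exact_mod_cast hl.pos
  have key := BIII_sub_gain_eq' (d := (Cor22.dmod P : ℝ)) (lD := P.logDiff) (lC := Cor22.logCondAvoid P {2, l})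
    (R := 2 * Real.log l + 52
      + 20 / 3 * Real.log (((2 ^ 12 * 3 ^ 3 * 5 * Cor22.dmod P : ℕ) : ℝ) * (l : ℝ))
        * (Nat.primeCounting (2 ^ 12 * 3 ^ 3 * 5 * Cor22.dmod P * l) : ℝ)) hl0
  have e : ((l : ℝ) + 1) / 4 *
        ((1 + 12 * (Cor22.dmod P : ℝ) / l) * (P.logDiff + Cor22.logCondAvoid P {2, l})
          + 2 * Real.log l + 52
          + 20 / 3 * Real.log (((2 ^ 12 * 3 ^ 3 * 5 * Cor22.dmod P : ℕ) : ℝ) * (l : ℝ))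
            * (Nat.primeCounting (2 ^ 12 * 3 ^ 3 * 5 * Cor22.dmod P * l) : ℝ)) =
      ((l : ℝ) + 1) / 4 *
        ((1 + 12 * (Cor22.dmod P : ℝ) / l) * (P.logDiff + Cor22.logCondAvoid P {2, l})
          + (2 * Real.log l + 52
            + 20 / 3 * Real.log (((2 ^ 12 * 3 ^ 3 * 5 * Cor22.dmod P : ℕ) : ℝ) * (l : ℝ))
              * (Nat.primeCounting (2 ^ 12 * 3 ^ 3 * 5 * Cor22.dmod P * l) : ℝ))) := by ring
  rw [e] at hmix
  linarith

/-- **The REGISTERED stub `stub_hullRegimeAboveBad` (RESHAPE-4, skeleton sha16 `3177a83aca8d622d`; = the `haboveBad` binder of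
`ThetaPartII.ABC_of_cor312Bad_of_hullRegimeAboveBad`, VERBATIM) IS FALSE MODULO ONE SZPIRO-BAD MIXED WITNESS ABOVE THE THRESHOLD**: as
`hregBad_false_of_szpiroBadMixedWitness`, the witness additionally carrying `2 ≤ d_mod` and abc-iut-c312-d1's prime-count threshold
`40·log(d*l)·(π(d*l) − (2d_mod(lD + lC) + log(30l))/log 2) < log q^{∤{2,l}}(λ)` (both VERBATIM). An implication; its antecedent is NOT asserted
(abc-iut-s2-p5's family `P_k` clears everything but the Szpiro-bad disjunct, which for it depends on unfactored norms). No side taken.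
[cite: Mochizuki2012, IUTchIV Thm. 1.10 Steps (v)–(viii) p. 27–31] [claim: Mochizuki2012, status: disputed] -/
theorem stub_hullRegimeAboveBad_false_of_szpiroBadMixedWitness
    (H : ∃ (P : NFPoint) (_ : P ∈ UP) (l : ℕ) (_ : l.Prime) (_ : 5 ≤ l) (_ : Cor22.AdmitsCore P)
        (_ : Cor22.CondP2 P l) (_ : Cor22.CondP5 P l) (_ : Cor22.CondP6 P l)
        (_ : ((l : ℝ) + 5) / 4 < (Cor22.dmod P : ℝ) ∨
          6 * l * (((l : ℝ) + 5) - 4 * Cor22.dmod P) / (((l : ℝ) + 4) * ((l : ℝ) - 3))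
              * (P.logDiff + (1 - 1 / (l : ℝ)) * Cor22.logCondAvoid P {2, l})
            + 6 * l * ((l : ℝ) + 5) / (((l : ℝ) + 4) * ((l : ℝ) - 3)) * Real.log Real.pi < Cor22.logQAvoid P {2, l})
        (_ : 2 ≤ Cor22.dmod P)
        (_ : 40 * Real.log (((2 ^ 12 * 3 ^ 3 * 5 * Cor22.dmod P : ℕ) : ℝ) * l)
          * ((Nat.primeCounting (2 ^ 12 * 3 ^ 3 * 5 * Cor22.dmod P * l) : ℝ)
            - (2 * (Cor22.dmod P : ℝ) * (P.logDiff + Cor22.logCondAvoid P {2, l}) + Real.log (2 * 3 * 5 * (l : ℝ)))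
              / Real.log 2) < Cor22.logQAvoid P {2, l})
        (_ : 4 * (Cor22.dmod P : ℝ) ≤ (l : ℝ) + 5)
        (p₀ : ℕ) (_ : p₀.Prime) (V W : HeightOneSpectrum (𝓞 P.F)) (_ : V ∈ placesOver P.F p₀) (_ : W ∈ placesOver P.F p₀)
        (_ : V ∈ Cor22.badPlacesAvoid P {2, l})
        (_ : W ∈ Cor22.badPlacesAvoid P {2, l} →
          (ord P.F V (Cor22.jInv P.x) : ℝ) * logNorm P.F V / (localDegree P.F V : ℝ) ≠
            (ord P.F W (Cor22.jInv P.x) : ℝ) * logNorm P.F W / (localDegree P.F W : ℝ))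
        (W₀ : Finset ℕ) (_ : ∀ p ∈ W₀, p.Prime)
        (_ : ∀ p ∈ W₀, 0 < ∑ U ∈ Finset.univ.filter
            (fun U : placesOver ↥(IntermediateField.adjoin ℚ ({Cor22.jInv P.x} : Set P.F)) p =>
              ¬ (ord _ U.1 (Cor22.jMod P) < 0 ∧ ((2 : ℕ) : 𝓞 _) ∉ U.1.asIdeal ∧ ((l : ℕ) : 𝓞 _) ∉ U.1.asIdeal)),
            weight _ U.1),
        (4 * (Cor22.dmod P : ℝ) - 1 + 3 * (Cor22.dmod P : ℝ) / l) * (P.logDiff + Cor22.logCondAvoid P {2, l})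
            + ((l : ℝ) + 5 - 4 * (Cor22.dmod P : ℝ)) / (4 * (l : ℝ)) * Cor22.logCondAvoid P {2, l}
            + ((l : ℝ) + 1) / 4 * (2 * Real.log l + 52
              + 20 / 3 * Real.log (((2 ^ 12 * 3 ^ 3 * 5 * Cor22.dmod P : ℕ) : ℝ) * (l : ℝ))
                * (Nat.primeCounting (2 ^ 12 * 3 ^ 3 * 5 * Cor22.dmod P * l) : ℝ)) <
          ∑ p ∈ W₀, (1 / (2 * (l : ℝ)) *
            ∑ U : placesOver ↥(IntermediateField.adjoin ℚ ({Cor22.jInv P.x} : Set P.F)) p,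
              (if ord _ U.1 (Cor22.jMod P) < 0 ∧ ((2 : ℕ) : 𝓞 _) ∉ U.1.asIdeal ∧ ((l : ℕ) : 𝓞 _) ∉ U.1.asIdeal then
                weight _ U.1 * (((-ord _ U.1 (Cor22.jMod P) : ℤ) : ℝ) * logNorm _ U.1 / (localDegree _ U.1 : ℝ))
               else 0)) *
            ((l : ℝ) * ((l : ℝ) + 1) / 12
              - 4 * (1 - ∑ U ∈ Finset.univ.filter
                    (fun U : placesOver ↥(IntermediateField.adjoin ℚ ({Cor22.jInv P.x} : Set P.F)) p =>
                      ¬ (ord _ U.1 (Cor22.jMod P) < 0 ∧ ((2 : ℕ) : 𝓞 _) ∉ U.1.asIdeal ∧ ((l : ℕ) : 𝓞 _) ∉ U.1.asIdeal)),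
                    weight _ U.1) /
                (((l : ℝ) - 1) * (∑ U ∈ Finset.univ.filter
                    (fun U : placesOver ↥(IntermediateField.adjoin ℚ ({Cor22.jInv P.x} : Set P.F)) p =>
                      ¬ (ord _ U.1 (Cor22.jMod P) < 0 ∧ ((2 : ℕ) : 𝓞 _) ∉ U.1.asIdeal ∧ ((l : ℕ) : 𝓞 _) ∉ U.1.asIdeal)),
                    weight _ U.1) ^ 3))) :
    ¬ (∀ P : NFPoint, P ∈ UP → ∀ l : ℕ, l.Prime → 5 ≤ l →
        Cor22.AdmitsCore P → Cor22.CondP2 P l → Cor22.CondP5 P l → Cor22.CondP6 P l →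
        (((l : ℝ) + 5) / 4 < (Cor22.dmod P : ℝ) ∨
          6 * l * (((l : ℝ) + 5) - 4 * Cor22.dmod P) / (((l : ℝ) + 4) * ((l : ℝ) - 3))
              * (P.logDiff + (1 - 1 / (l : ℝ)) * Cor22.logCondAvoid P {2, l})
            + 6 * l * ((l : ℝ) + 5) / (((l : ℝ) + 4) * ((l : ℝ) - 3)) * Real.log Real.pi < Cor22.logQAvoid P {2, l}) →
        2 ≤ Cor22.dmod P →
        40 * Real.log (((2 ^ 12 * 3 ^ 3 * 5 * Cor22.dmod P : ℕ) : ℝ) * l)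
          * ((Nat.primeCounting (2 ^ 12 * 3 ^ 3 * 5 * Cor22.dmod P * l) : ℝ)
            - (2 * (Cor22.dmod P : ℝ) * (P.logDiff + Cor22.logCondAvoid P {2, l}) + Real.log (2 * 3 * 5 * (l : ℝ)))
              / Real.log 2) < Cor22.logQAvoid P {2, l} →
        ∀ T : Cor22.ThetaVolumeDatumAt P l,
          (letI := T.instFieldF; letI := T.instNumberFieldF; letI := T.instAlgebraF; letI := T.instFieldK
           letI := T.instNumberFieldK; letI := T.instAlgebraK; letI := T.instFieldFbar; letI := T.instAlgebraFbar
           letI := T.instAlgebraKFbar; letI := T.instIsElliptic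
           ¬ (∀ p ∈ T.I.supportPrimes, ∀ v w : placesOver (fieldOfModuli T.E) p,
              (Summit.ABC.IUTFork.DHData.ofInput T.I).logQloc p v = (Summit.ABC.IUTFork.DHData.ofInput T.I).logQloc p w)) →
          T.HullEstimateOf
            (((l : ℝ) + 1) / 4 *
              ((1 + 12 * (Cor22.dmod P : ℝ) / l) * (P.logDiff + Cor22.logCondAvoid P {2, l})
                + 2 * Real.log l + 52
                + 20 / 3 * Real.log (((2 ^ 12 * 3 ^ 3 * 5 * Cor22.dmod P : ℕ) : ℝ) * (l : ℝ))
                  * (Nat.primeCounting (2 ^ 12 * 3 ^ 3 * 5 * Cor22.dmod P * l) : ℝ)))) := by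
  intro haboveBad
  obtain ⟨P, hP, l, hl, h5, hcore, h2, h5', h6, hbad, hd2, hthr, h4d, p₀, hp₀, V, W, hV, hW, hVb, hne, W₀, hW₀, hω, hlt⟩ := H
  haveI : Fact p₀.Prime := ⟨hp₀⟩
  obtain ⟨T⟩ := Summit.ABC.ABC.Theorems.ThetaPartII.stub_thetaData P hP l hl h5 hcore h2 h5' h6
  have hns := not_slotConstant_of_unequalHeightsPoint T hV hW hVb hne
  have hT := haboveBad P hP l hl h5 hcore h2 h5' h6 hbad hd2 hthr T hns
  have hmix := pointMixedShare_le_sub_gain_of_hullEstimateOf T hT hl.pos h4d W₀ hW₀ hω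
  have hl0 : (0 : ℝ) < (l : ℝ) := by exact_mod_cast hl.pos
  have key := BIII_sub_gain_eq' (d := (Cor22.dmod P : ℝ)) (lD := P.logDiff) (lC := Cor22.logCondAvoid P {2, l})
    (R := 2 * Real.log l + 52
      + 20 / 3 * Real.log (((2 ^ 12 * 3 ^ 3 * 5 * Cor22.dmod P : ℕ) : ℝ) * (l : ℝ))
        * (Nat.primeCounting (2 ^ 12 * 3 ^ 3 * 5 * Cor22.dmod P * l) : ℝ)) hl0
  have e : ((l : ℝ) + 1) / 4 *
        ((1 + 12 * (Cor22.dmod P : ℝ) / l) * (P.logDiff + Cor22.logCondAvoid P {2, l})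
          + 2 * Real.log l + 52
          + 20 / 3 * Real.log (((2 ^ 12 * 3 ^ 3 * 5 * Cor22.dmod P : ℕ) : ℝ) * (l : ℝ))
            * (Nat.primeCounting (2 ^ 12 * 3 ^ 3 * 5 * Cor22.dmod P * l) : ℝ)) =
      ((l : ℝ) + 1) / 4 *
        ((1 + 12 * (Cor22.dmod P : ℝ) / l) * (P.logDiff + Cor22.logCondAvoid P {2, l})
          + (2 * Real.log l + 52
            + 20 / 3 * Real.log (((2 ^ 12 * 3 ^ 3 * 5 * Cor22.dmod P : ℕ) : ℝ) * (l : ℝ))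
              * (Nat.primeCounting (2 ^ 12 * 3 ^ 3 * 5 * Cor22.dmod P * l) : ℝ))) := by ring
  rw [e] at hmix
  linarith

/-- **The first Szpiro-bad disjunct is outside the reach of the sharp necessity**: `(l+5)/4 < d_mod` contradicts `4·d_mod ≤ l + 5`, so every
witness of the two lemmas above uses the SECOND disjunct (`log q^{∤{2,l}}(λ)` beyond `≈ 6·(log-diff + log-cond)`). Pure arithmetic, recorded
for JOB N4's predicate. [folklore] -/
theorem szpiroBad_second_disjunct_of_le {l d A Q : ℝ} (h4d : 4 * d ≤ l + 5) (h : (l + 5) / 4 < d ∨ A < Q) : A < Q := by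
  rcases h with h1 | h2
  · exfalso; linarith
  · exact h2

end Summit.ABC.ABC.Theorems.ThetaPartII.Negative

end
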